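import Literature.NumberTheory.EllipticCurves.AnticyclotomicSignedTransferTheorem
import Literature.NumberTheory.EllipticCurves.AnticyclotomicSignedSelmerRelaxedEquality
import Summits.BirchSwinnertonDyer.BirchSwinnertonDyer.Theorems.SignedBaseChangeAnticyclotomicEisensteinDivisibilityAnticyclotomicNonsplit
import Summits.BirchSwinnertonDyer.BirchSwinnertonDyer.Theorems.SignedBaseChangeAnticyclotomicEisensteinDivisibilityEisensteinTransfer
import Literature.NumberTheory.EllipticCurves.CastellaHsuKunduLeeLiu2025.HeegnerPointMainConjectureSupersingularBDP
import HarnessLib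

/-!
# Line `admdef` on crux `AnticyclotomicEisensteinDivisibility` (stmt-BirchSwinnertonDyer-20727) — supplement `admdef_transfer`:
# THE CERTIFIED CUT of the load-bearing stub `stub_chkllPlusRat` (C⁺⁺): C⁺⁺ ⟸ [R] (research, `±`-HPMC rigidity) + two printed facts,
# the transfer [E] being PROVED here over the LEAD's tree theorem p634573 (rev 2); [R] re-quantified with the period normalisation
# `IsCWBDPLFunction … L` pinning `(z, L)` (rev 3 = repair C′ of the critic's price π2, V#27l; critic V#27m PASS); rev 4 adds the cut on the
# REGISTERED skeleton's narrowed obligation C⁺⁺_NS (`AdmdefLine.CHKLLPlusRatNS`, LEAD v2 cee32bd27dbcd0ea): C⁺⁺_NS ⟸ [R_NS] + the same two facts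

Ideator seat bsd-idea-5 g20 (D-0145, lens «transfer»; W-79 publish-only: written with `ledger crux write` / attached as
evidence, never `skeleton check`ed by this seat). Companion of `Lines/admdef.lean` (v1 by this seat, sha16 250e556845f48d5c, operator-registered 13:29Z per director-bsd (394)(1); SKELETON
OF RECORD since 13:47Z = the LEAD bsd-line-sbc-p1 gen 15's v2, sha16 cee32bd27dbcd0ea, commit 451f35fb4a92, `PICKED: admdef`, research stub
narrowed to `stub_chkllPlusRatNS : CHKLLPlusRatNS`; farm rc 0, 5 stubs)
and of the LINE CARD `Lines/admdef.md` (rev 4 → rev 5 §Addendum (e)). THIS FILE HAS NO `sorry`.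

CONTENTS.
* `EisensteinTransferSS` — [E], the EISENSTEIN-direction (`⊆ (L)`) transfer "signed rigidity ⟹ BDP lower half" in the tree's
  `±` currency, TYPED as the binder-for-binder mirror of the proved Howard-direction transfer
  `AcSigned.TransferInputs.mem_XAc_charIdeal_map_of_howard` with (1) the Howard inequality REVERSED with `p`-power slack, (2) the extra
  containment hypothesis `Sel^{ε, rel at 𝔭'}(K, 𝐓^ac) ≤ Sel_ε(K, 𝐓^ac)` (the instance of conjunct 5), (3) the conclusion REVERSED with
  slack on `AcSelmer.XAc` — **and PROVED (`eisensteinTransferSS_holds`, rev 2)** in a dozen lines over the LEAD's width-seat theorem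
  `…Theorems.SignedBaseChangeAcDivEisensteinTransfer.TransferInputs.span_pow_mul_XAc_charIdeal_map_le_span` (bsd-line-sbc-p1-w2 gen 5,
  p634573: Castella–Wan (6.12)–(6.16) run for the opposite divisibility on the tree's carriers), with `hinj` from
  `AcSigned.TransferInputs.locSignedAt_injective` and `hEq` from hypothesis (2). Rev 1 of this file (commit e071017265b5) called [E]
  "benchable"; that is WITHDRAWN — it is a theorem, nothing is left to bench.
* `HPMCPlusRigidityRat N W K p κ 𝔭 𝔭'` — [R], the rigidity half of the `±` Heegner point main conjecture in rational form at
  ARBITRARY conductor under the CHKLL hypotheses minus `Squarefree N`, TYPED in the frame of conjunct 3 (`Setting`, newform,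
  `N⁻ = 1`, embedding datum) + `5 ≤ p`, `Surj`, `(N, D_K) = 1`, (ii) all-ramified: for every `TransferInputs … ε z L`, ranks one
  and the reversed rational Howard inequality. RESEARCH (in print only for square-free `N`: CHKLL25 Thm. 7.1 ⟸ Thm. 7.4).
* `CHKLLPlusRatE` — VERBATIM copy of `AdmdefLine.CHKLLPlusRat` (C⁺⁺) of `Lines/admdef.lean` (this supplement cannot import the
  unregistered line file); identification CHECKED in a scratch file concatenating both (`example : CHKLLPlusRat ↔ CHKLLPlusRatE
  := Iff.rfl`, farm rc 0, scratch sha16 recorded on the card); `chkll_of_chkllPlusRatE` (PROVED) pins the binder order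
  against the printed fact `CastellaHsuKunduLeeLiu2025.thm71_cor72_…_rat`.
* `chkllPlusRatE_of_transfer` — **PROVED (plumbing, kernel-checked): conjunct 3 ∧ conjunct 5 ∧ (∀ frame, [R]) ∧ [E] ⟹ C⁺⁺**, and its
  final form `chkllPlusRatE_of_rigidity` — **conjunct 3 ∧ conjunct 5 ∧ (∀ frame, [R]) ⟹ C⁺⁺** ([E] discharged),
  where conjunct 3 = `AcSigned.castellaWan2024_proofThm68_transferInputs` (PRINT, already a conjunct of `stub_namedFactsSS`
  v37) and conjunct 5 = `AcSigned.castellaWan2024_proofThm68_selmerRel_le_selmerSgn` (PRINT, refereed, Castella–Wan MS p. 30;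
  NOT among v37's eleven — a new BY-NAME print hypothesis in the sense of director-bsd (385)(2)), glued by the tree theorem
  `…Theorems.SignedBaseChangeAcDivAnticyclotomicNonsplit.isNonsplitIn_of_isAnticyclotomic_of_not_dvd_classNumber`
  (`p ∤ h_K` ⟹ `𝔭` non-split in `K_∞⁻`), the construction of `AcSigned.Setting` from C⁺⁺'s binders (`a_p = 0` ⟹ `GoodSS`),
  a local generator `γ𝔭` from the surjectivity `IsNonsplitIn`, and the sign `ε = 1`.
* REV 4 (on the REGISTERED obligation): `HPMCPlusRigidityRatNS` — [R_NS] = [R] with the extra binder `¬ Squarefree N`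
  (`hpmcPlusRigidityRatNS_of_rat`: [R] ⟹ [R_NS]); `CHKLLPlusRatNSE` — VERBATIM copy of the LEAD's `AdmdefLine.CHKLLPlusRatNS`
  (identification `example : CHKLLPlusRatNS ↔ AdmdefLine.CHKLLPlusRatNSE := Iff.rfl` CHECKED against ll. 105–135 of the registered
  v2 bytes in the scratch `scratch-nse-iff.lean` = these bytes ++ that block ++ the `example`, farm rc 0, attached as evidence on
  item 20727 next to this rev); `chkllPlusRatNSE_of_chkllPlusRatE`
  (C⁺⁺ ⟹ C⁺⁺_NS, PROVED); **`chkllPlusRatNSE_of_rigidityNS` — PROVED: conjunct 3 ∧ conjunct 5 ∧ (∀ frame, [R_NS]) ⟹ C⁺⁺_NS**, i.e. the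
  research content of the registered stub `stub_chkllPlusRatNS` is, certifiably, the `±`-HPMC rigidity in rational form on
  NON-square-free `N` in the period-normalised frame, with two PRINTED Castella–Wan facts by name.

RELATION TO THE SKELETON OF RECORD (honest placement). This is the LEAD's own v33 ↔ v36 equivalence "Form T (signed-Heegner currency,
Eisenstein `⊆`) ≡ S1 (BDP currency)" (kernel glue p649794 ∘ p634573, converse p680159), instantiated on the β-CUT C⁺⁺ (CHKLL's frame
`IsCWBDPLFunction` = conjunct 3's frame, strict prime `𝔭bar`): the research debt of `stub_chkllPlusRat` is, certifiably, [R] — the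
`±`-HPMC rigidity (ranks one + the Eisenstein divisibility `∃ k, (p^k)·char_t(X_ε) ⊆ ι(char(Sel_ε/Λz))²`) at arbitrary conductor under
CHKLL's hypotheses minus square-freeness — which is the currency in which the card's mechanism (level raising at BD-admissible primes, the
`±` bipartite Euler system, CHKLL Thm. 7.4 → Thm. 7.1, PORT label (P1)) actually operates. The LEAD chose (v36) to REGISTER the debt in BDP
currency to keep CW Lemma 6.7 / "`Sel_± = Sel^{±,rel}`" and the binders `z`, `TransferInputs`, `h𝔭 γ𝔭 hγ𝔭` out of the skeleton; this
supplement does not second-guess that — it records, kernel-checked, that for the β-cut the two currencies are ONE research statement apart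
([R]) with conjunct 5 as the only extra print input, so that a line for the PROMOTED item arguing through Kolyvagin / bipartite systems can
start from `HPMCPlusRigidityRat` with the BDP side already closed. CONSEQUENCE (the LEAD's / pen's call — W-79: not this seat's): IF the
line is ever registered with C⁺⁺ cut, the cut is `stub_hpmcPlusRigidityRat : ∀ N W K p κ 𝔭 𝔭', HPMCPlusRigidityRat …` (RESEARCH) +
conjunct 5 BY NAME, C⁺⁺ DERIVED by `chkllPlusRatE_of_rigidity`; NO benchable stub arises from this cut (the 12:20Z / 13:25Z "[E]
benchable" suggestion under director-bsd (383) is withdrawn). Nothing research-grade is proved here; BSD, the crux, C⁺⁺ and [R] are NOT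
proved by any of this.
-/

noncomputable section

open scoped Classical

open PowerSeries NumberField IsDedekindDomain Field
open Literature.NumberTheory.EllipticCurves Literature.NumberTheory.GaloisRepresentations
open Literature.NumberTheory.EllipticCurves.IwasawaDual
open Literature.NumberTheory.EllipticCurves.ModularForms Literature.NumberTheory.EllipticCurves.Castella2018
open Literature.NumberTheory.EllipticCurves.CastellaWan2024
open Literature.NumberTheory.EllipticCurves.AcSigned

set_option linter.dupNamespace false

namespace Summit.BirchSwinnertonDyer.BirchSwinnertonDyer.Cruxes.AnticyclotomicEisensteinDivisibility.AdmdefLine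

/-- **[E] `EisensteinTransferSS` — the Eisenstein-direction (`⊆ (L)`) transfer "signed rigidity ⟹ BDP lower
half", rational form, in the tree's `±` currency.** For `E/ℚ` elliptic with model `W`, base-changed to a number
field `K`, a `ℤ_p`-extension `κ` with topological generator `γ`, primes `𝔭 ≠ 𝔭'` of `K` above `p` with `𝔭`
non-split in `κ` and a matching local generator `γ𝔭`, a sign `ε`, a class `z ∈ Sel_ε(K, 𝐓^ac)` and `L ∈ R₀⟦T⟧`
with the six Castella–Wan transfer inputs `TransferInputs … ε z L`: IF `Sel_ε(K, 𝐓^ac)` and `X_ε` have `Λ`-rank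
one, `Sel^{ε, rel at 𝔭'}(K, 𝐓^ac) ≤ Sel_ε(K, 𝐓^ac)`, and the REVERSED Howard inequality holds rationally —
`∃ k, (p^k) · char_t(X_ε) ⊆ ι(char_Λ(Sel_ε(K, 𝐓^ac)/Λ z))²` — THEN along every structure map `j : ℤ_p → R₀`
compatible with `ℤ_p ⊂ ℂ_p` there is `k′` with `(p^{k′}) · Ch_Λ(X_ac(E[p^∞])) · R₀⟦T⟧ ⊆ (L)` (`X_ac` = the tree
object `Castella2018.AcSelmer.XAc … 𝔭' ∅ γ`, strict at `𝔭'`). Mirror of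
`AcSigned.TransferInputs.mem_XAc_charIdeal_map_of_howard`; module algebra, no arithmetic input beyond the
hypotheses; PROVED below (`eisensteinTransferSS_holds`) over the tree theorem p634573. [cite: CastellaWan2023, Thm. 6.8 "the same result holds for the
opposite divisibilities" and its proof (6.12)–(6.16) (MS pp. 29–31)] [cite: Castella2018, Def. 2.2] -/
def EisensteinTransferSS : Prop :=
  ∀ {K : Type} [Field K] [NumberField K] {W : WeierstrassCurve ℚ} [W.IsElliptic] {p : ℕ} [Fact p.Prime]
    {κ : ZpExtension K p} {γ : absoluteGaloisGroup K} [hγF : Fact (κ.IsTopGenerator γ)]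
    {𝔭 : HeightOneSpectrum (𝓞 K)} {h𝔭 : IsNonsplitIn κ 𝔭} {γ𝔭 : absoluteGaloisGroup (𝔭.adicCompletion K)}
    {hγ𝔭 : κ (resGalOfEmb (closureEmb (K := K) (𝔭.adicCompletion K)) γ𝔭) = κ γ}
    {𝔭' : HeightOneSpectrum (𝓞 K)} {h𝔭𝔭' : 𝔭 ≠ 𝔭'} {h𝔭p : ((p : ℕ) : 𝓞 K) ∈ 𝔭.asIdeal} {ε : ℤˣ}
    {z : selmerLambdaAdic (W.baseChange K) p κ γ (fun _ ↦ .sgn ε)} {L : UnrSeries p},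
    TransferInputs (W.baseChange K) p κ γ hγF.out 𝔭 h𝔭 γ𝔭 hγ𝔭 𝔭' h𝔭𝔭' h𝔭p ε z L →
    ((p : ℕ) : 𝓞 K) ∈ 𝔭'.asIdeal →
    selmerLambdaAdic.HasRank (W.baseChange K) p κ γ hγF.out (fun _ ↦ .sgn ε) 1 →
    X.HasRank (W.baseChange K) p κ ∅ (fun _ ↦ .sgn ε) hγF.out 1 →
    selmerLambdaAdic (W.baseChange K) p κ γ (PCond.at 𝔭' .rel (.sgn ε)) ≤
      selmerLambdaAdic (W.baseChange K) p κ γ (fun _ ↦ .sgn ε) →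
    (∃ k : ℕ, Ideal.span {PowerSeries.C ((p : ℤ_[p]) ^ k)} *
        X.torsionCharIdeal (W.baseChange K) p κ ∅ (fun _ ↦ .sgn ε) hγF.out ≤
      (signedHeegnerCharIdeal hγF.out ε z).map (IwasawaAlgebra.invol p) ^ 2) →
    ∀ (j : ℤ_[p] →+* unrIntegers p),
      (∀ x : ℤ_[p], ((j x : unrIntegers p) : ℂ_[p]) = algebraMap ℚ_[p] ℂ_[p] (x : ℚ_[p])) →
      ∃ k' : ℕ,
        Ideal.span {PowerSeries.C ((p : unrIntegers p) ^ k')} *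
            (Castella2018.AcSelmer.XAc.charIdeal (W.baseChange K) p κ 𝔭' ∅ γ).map (PowerSeries.map j) ≤
          Ideal.span {L}


/-- **[E] IS A THEOREM (PROVED here, a few lines over the tree): `EisensteinTransferSS` holds.** The LEAD's width seat
bsd-line-sbc-p1-w2 (gen 5) proved the Eisenstein-direction transfer on the tree's carriers as
`…Theorems.SignedBaseChangeAcDivEisensteinTransfer.TransferInputs.span_pow_mul_XAc_charIdeal_map_le_span` (p634573) with side
hypotheses `hinj` (`loc_𝔭` injective on `Sel_ε`) and `hEq` (every `loc_𝔭`-image of `Sel^{ε,rel}` is one of `Sel_ε`); `hinj` is the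
tree's `AcSigned.TransferInputs.locSignedAt_injective` fed with the rank-one hypothesis, `hEq` is immediate from the containment
hypothesis (2) (`⟨⟨x'.1, hRel x'.2⟩, Subtype.ext rfl⟩`, as in `…TransferSideEq.hEq_of_literature`), and the two `p`-power slacks
are the same ideal generators (`PowerSeries.C (p^k) = (p : Λ)^k`). So the ONLY non-print input of the cut below is [R]. -/
theorem eisensteinTransferSS_holds : EisensteinTransferSS := by
  intro K _ _ W _ p _ κ γ hγF 𝔭 h𝔭 γ𝔭 hγ𝔭 𝔭' h𝔭𝔭' h𝔭p ε z L hT h𝔭'p hS hX hRel hHP j hj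
  obtain ⟨k, hk⟩ := hHP
  have hinj := AcSigned.TransferInputs.locSignedAt_injective hT hS
  have hEq : ∀ x' : selmerLambdaAdic (W.baseChange K) p κ γ (PCond.at 𝔭' .rel (.sgn ε)),
      ∃ x : selmerLambdaAdic (W.baseChange K) p κ γ (fun _ ↦ .sgn ε),
        locSignedAt (W.baseChange K) p κ 𝔭 h𝔭 γ γ𝔭 hγ𝔭 (fun _ ↦ .sgn ε) ε rfl h𝔭p x =
          locSignedAt (W.baseChange K) p κ 𝔭 h𝔭 γ γ𝔭 hγ𝔭 (PCond.at 𝔭' .rel (.sgn ε)) ε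
            (PCond.at_of_ne .rel (.sgn ε) h𝔭𝔭') h𝔭p x' :=
    fun x' ↦ ⟨⟨x'.1, hRel x'.2⟩, Subtype.ext rfl⟩
  have hCp : PowerSeries.C ((p : ℤ_[p]) ^ k) = ((p : ℕ) : IwasawaAlgebra p) ^ k := by
    rw [map_pow, map_natCast]
  have hCu : PowerSeries.C ((p : unrIntegers p) ^ k) = ((p : ℕ) : UnrSeries p) ^ k := by
    rw [map_pow, map_natCast]
  rw [hCp] at hk
  refine ⟨k, ?_⟩
  rw [hCu]
  exact Summit.BirchSwinnertonDyer.BirchSwinnertonDyer.Theorems.SignedBaseChangeAcDivEisensteinTransfer.TransferInputs.span_pow_mul_XAc_charIdeal_map_le_span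
    hT h𝔭'p hinj hX hEq hk j hj

/-- **[R] `HPMCPlusRigidityRat` — rigidity half of the `±` Heegner point main conjecture, rational form, at ARBITRARY
conductor under the CHKLL hypotheses minus square-freeness (RESEARCH statement; typed, not proved).** In the frame of
conjunct 3 `AcSigned.castellaWan2024_proofThm68_transferInputs N W K p κ 𝔭 𝔭'` (its `Setting`, newform `f` of level
`N = N_E`, `N⁻ = 1`, the embedding datum at `𝔭`), and additionally `5 ≤ p`, `ρ̄_{E,p}` surjective, `(N, D_K) = 1` and
(ii) `E[p]` ramified at every prime `q ∣ N` (NO `Squarefree N`): for every topological generator `γ`, `𝔭` non-split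
datum `(h𝔭, γ𝔭, hγ𝔭)`, period pair `(Ω_K ≠ 0, Ω_p)`, sign `ε`, class `z` and series `L` such that `L` IS the
Castella–Wan–BDP `p`-adic `L`-function for these periods (`IsCWBDPLFunction ι 𝔭 κ γ f D_K Ω_K Ω_p L` — exactly the
normalisation conjunct 3 delivers; it PINS `L` up to `(Λ^ur)ˣ`, hence, through `TransferInputs.signedLog_erl` and the
injectivity of `loc_𝔭` on `Sel_ε`, pins `z` up to `Λˣ`) and `TransferInputs … ε z L` holds, the modules `Sel_ε(K, 𝐓^ac)`
and `X_ε` have `Λ`-rank one and the REVERSED Howard inequality holds rationally: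
`∃ k, (p^k) · char_t(X_ε) ⊆ ι(char_Λ(Sel_ε/Λ z))²`. (REV 3 REPAIR of the critic's price π2, V#27l: revs 1–2 left `(z, L)`
free under `TransferInputs` alone, which is SCALE-COVARIANT — `(z, L) ↦ (g•z, ι(g)²L)` — while the conclusion is not
(`char(Sel_ε/Λ·g z) = (g)·char(Sel_ε/Λ z)`), so the unpinned statement held iff its frame was empty; the period
normalisation is the repair C′ named by the critic, and `IsCWBDPLFunction` enters as the NORMALISATION of `z`, not as a
BDP-side claim.) This is the `±`-currency form of the Eisenstein half of the signed
Heegner point main conjecture beyond square-free level — in print only for `N` square-free [CHKLL25 Thm. 7.1 ⟸ the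
`±` bipartite Euler system of Thm. 7.4 = DI08 §4 + PW11 §4.3 + the CGLS-type argument]; its port to arbitrary `N⁺` is
the research content of this line (K3 / T5′-type stubs + K2 + PORT label (P1) of the card; reliability flag
`CHKLL-inputs`). Together with [E] `EisensteinTransferSS`, conjunct 3, conjunct 5
`AcSigned.castellaWan2024_proofThm68_selmerRel_le_selmerSgn` and `Setting`-from-binders plumbing it is meant to yield
`CHKLLPlusRat` (C⁺⁺) of `Lines/admdef.lean`; that composition is NOT in this file. OPEN.
[cite: CastellaEtAl2025, Thm. 7.1, Thm. 7.4, Cor. 7.2 (arXiv:2308.10474v2 pp. 29–33)] [cite: CastellaWan2023, Thm. 6.8 (MS p. 30)] -/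
def HPMCPlusRigidityRat (N : ℕ) [NeZero N] (W : WeierstrassCurve ℚ) [W.IsGloballyMinimal] (K : Type) [Field K]
    [NumberField K] (p : ℕ) [Fact p.Prime] (κ : ZpExtension K p) (𝔭 𝔭' : HeightOneSpectrum (𝓞 K)) : Prop :=
  ∀ (hS : Setting W K p κ 𝔭 𝔭') (ι : PadicAlgCl p ≃+* ℂ) {f : CuspForm (CongruenceSubgroup.Gamma0 N) 2}
    (_ : IsNewformOf W f), (W.conductorNorm ℤ : ℕ) = N → SatisfiesHeegnerHypothesis N K → 5 ≤ p →
    Rank1Residual.Surj W p → IsCoprime (N : ℤ) (NumberField.discr K) →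
    (∀ q : ℕ, q.Prime → q ∣ N →
      ∃ v : HeightOneSpectrum (𝓞 ℚ), ((q : ℕ) : 𝓞 ℚ) ∈ v.asIdeal ∧
        ∃ 𝔓 ∈ v.primesAbove, ∃ σ ∈ 𝔓.inertia (absoluteGaloisGroup ℚ),
          ∃ P : W.geomTorsion (p : ℤ), σ • P ≠ P) →
    (∀ (w : InfinitePlace K) (k : 𝓞 K), k ∈ 𝔭.asIdeal ↔ ‖ι.symm (w.embedding (k : K))‖ < 1) →
    ∀ (γ : absoluteGaloisGroup K) (hγ : κ.IsTopGenerator γ) (h𝔭 : IsNonsplitIn κ 𝔭)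
      (γ𝔭 : absoluteGaloisGroup (𝔭.adicCompletion K))
      (hγ𝔭 : κ (resGalOfEmb (closureEmb (K := K) (𝔭.adicCompletion K)) γ𝔭) = κ γ)
      (ΩK : ℂ) (Ωp : (unrIntegers p)ˣ) (ε : ℤˣ)
      (z : selmerLambdaAdic (W.baseChange K) p κ γ (fun _ ↦ .sgn ε)) (L : UnrSeries p),
      ΩK ≠ 0 → IsCWBDPLFunction ι 𝔭 κ γ f (NumberField.discr K) ΩK ((Ωp : unrIntegers p) : ℂ_[p]) L →
      letI := hS.isElliptic
      TransferInputs (W.baseChange K) p κ γ hγ 𝔭 h𝔭 γ𝔭 hγ𝔭 𝔭' (fun h ↦ hS.ne h.symm) hS.mem ε z L →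
      selmerLambdaAdic.HasRank (W.baseChange K) p κ γ hγ (fun _ ↦ .sgn ε) 1 ∧
      X.HasRank (W.baseChange K) p κ ∅ (fun _ ↦ .sgn ε) hγ 1 ∧
      ∃ k : ℕ, Ideal.span {PowerSeries.C ((p : ℤ_[p]) ^ k)} *
          X.torsionCharIdeal (W.baseChange K) p κ ∅ (fun _ ↦ .sgn ε) hγ ≤
        (signedHeegnerCharIdeal hγ ε z).map (IwasawaAlgebra.invol p) ^ 2


/-- **[R_NS] `HPMCPlusRigidityRatNS` — [R] NARROWED to the registered skeleton's obligation (rev 4):** the same statement with the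
extra binder `¬ Squarefree N` inserted after `IsCoprime (N : ℤ) (discr K)`, byte-parallel to the LEAD's narrowing `CHKLLPlusRat` →
`CHKLLPlusRatNS` in the REGISTERED skeleton `Lines/admdef.lean` v2 (sha16 cee32bd27dbcd0ea, commit 451f35fb4a92): at square-free `N`
the `±`-rigidity is CHKLL25 Thm. 7.1 itself (print), so the research obligation is the NON-square-free case only. Trivially implied by
[R] (`hpmcPlusRigidityRatNS_of_rat`). OPEN (research). [cite: CastellaEtAl2025, Thm. 7.1 (arXiv:2308.10474v2 p. 29)] -/
def HPMCPlusRigidityRatNS (N : ℕ) [NeZero N] (W : WeierstrassCurve ℚ) [W.IsGloballyMinimal] (K : Type) [Field K]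
    [NumberField K] (p : ℕ) [Fact p.Prime] (κ : ZpExtension K p) (𝔭 𝔭' : HeightOneSpectrum (𝓞 K)) : Prop :=
  ∀ (hS : Setting W K p κ 𝔭 𝔭') (ι : PadicAlgCl p ≃+* ℂ) {f : CuspForm (CongruenceSubgroup.Gamma0 N) 2}
    (_ : IsNewformOf W f), (W.conductorNorm ℤ : ℕ) = N → SatisfiesHeegnerHypothesis N K → 5 ≤ p →
    Rank1Residual.Surj W p → IsCoprime (N : ℤ) (NumberField.discr K) → ¬ Squarefree N →
    (∀ q : ℕ, q.Prime → q ∣ N →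
      ∃ v : HeightOneSpectrum (𝓞 ℚ), ((q : ℕ) : 𝓞 ℚ) ∈ v.asIdeal ∧
        ∃ 𝔓 ∈ v.primesAbove, ∃ σ ∈ 𝔓.inertia (absoluteGaloisGroup ℚ),
          ∃ P : W.geomTorsion (p : ℤ), σ • P ≠ P) →
    (∀ (w : InfinitePlace K) (k : 𝓞 K), k ∈ 𝔭.asIdeal ↔ ‖ι.symm (w.embedding (k : K))‖ < 1) →
    ∀ (γ : absoluteGaloisGroup K) (hγ : κ.IsTopGenerator γ) (h𝔭 : IsNonsplitIn κ 𝔭)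
      (γ𝔭 : absoluteGaloisGroup (𝔭.adicCompletion K))
      (hγ𝔭 : κ (resGalOfEmb (closureEmb (K := K) (𝔭.adicCompletion K)) γ𝔭) = κ γ)
      (ΩK : ℂ) (Ωp : (unrIntegers p)ˣ) (ε : ℤˣ)
      (z : selmerLambdaAdic (W.baseChange K) p κ γ (fun _ ↦ .sgn ε)) (L : UnrSeries p),
      ΩK ≠ 0 → IsCWBDPLFunction ι 𝔭 κ γ f (NumberField.discr K) ΩK ((Ωp : unrIntegers p) : ℂ_[p]) L →
      letI := hS.isElliptic
      TransferInputs (W.baseChange K) p κ γ hγ 𝔭 h𝔭 γ𝔭 hγ𝔭 𝔭' (fun h ↦ hS.ne h.symm) hS.mem ε z L →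
      selmerLambdaAdic.HasRank (W.baseChange K) p κ γ hγ (fun _ ↦ .sgn ε) 1 ∧
      X.HasRank (W.baseChange K) p κ ∅ (fun _ ↦ .sgn ε) hγ 1 ∧
      ∃ k : ℕ, Ideal.span {PowerSeries.C ((p : ℤ_[p]) ^ k)} *
          X.torsionCharIdeal (W.baseChange K) p κ ∅ (fun _ ↦ .sgn ε) hγ ≤
        (signedHeegnerCharIdeal hγ ε z).map (IwasawaAlgebra.invol p) ^ 2

/-- [R] ⟹ [R_NS] (PROVED, one binder dropped). -/
theorem hpmcPlusRigidityRatNS_of_rat {N : ℕ} [NeZero N] {W : WeierstrassCurve ℚ} [W.IsGloballyMinimal] {K : Type} [Field K]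
    [NumberField K] {p : ℕ} [Fact p.Prime] {κ : ZpExtension K p} {𝔭 𝔭' : HeightOneSpectrum (𝓞 K)}
    (h : HPMCPlusRigidityRat N W K p κ 𝔭 𝔭') : HPMCPlusRigidityRatNS N W K p κ 𝔭 𝔭' :=
  fun hS ι _ hf hN hHeeg hp hsurj hcop _ hram hι ↦ h hS ι hf hN hHeeg hp hsurj hcop hram hι


/-! ## The composition (PROVED, plumbing only): [E] + [R] + conjunct 3 + conjunct 5 ⟹ C⁺⁺; final form [R] + conjuncts 3, 5 ⟹ C⁺⁺

`CHKLLPlusRatE` below is `AdmdefLine.CHKLLPlusRat` of `Lines/admdef.lean` VERBATIM (same binders, same conclusion; restated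
here only because this supplement cannot import the unregistered line file — the LEAD identifies the two by `Iff.rfl`-shape
`exact`). The theorem `chkllPlusRatE_of_transfer` CERTIFIES the cut of the card's Addendum (c2): the research content of
`stub_chkllPlusRat` is exactly [R] (`HPMCPlusRigidityRat`, the `±`-rigidity beyond square-free level), the rest is the
module-algebra transfer [E] (PROVED below, `eisensteinTransferSS_holds`, over p634573) and two PRINTED Castella–Wan facts BY NAME (conjunct 3
`castellaWan2024_proofThm68_transferInputs` — already a conjunct of `stub_namedFactsSS` v37 — and conjunct 5
`castellaWan2024_proofThm68_selmerRel_le_selmerSgn`, refereed, MS p. 30, NOT among v37's eleven), glued by the tree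
theorem `isNonsplitIn_of_isAnticyclotomic_of_not_dvd_classNumber` (p ∤ h_K ⟹ `𝔭` non-split in `K_∞⁻`) and the
construction of `AcSigned.Setting` from the binders. Nothing research-grade is proved. -/

/-- `C⁺⁺` — VERBATIM copy of `AdmdefLine.CHKLLPlusRat` (`Lines/admdef.lean`, sha16 250e556845f48d5c): CHKLL25 Cor. 7.2 (rational
Eisenstein half of the BDP main conjecture, `p ≥ 5` supersingular, `a_p = 0`) with hypothesis (i) `Squarefree N` DELETED and (ii)
`E[p]` ramified at every `q ∣ N` kept. OPEN (research). [cite: CastellaEtAl2025, Thm. 7.1, Cor. 7.2 (arXiv:2308.10474v2 pp. 29–33)] -/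
def CHKLLPlusRatE : Prop :=
  ∀ {p : ℕ} [Fact p.Prime] (ι : PadicAlgCl p ≃+* ℂ) (W : WeierstrassCurve ℚ) [W.IsElliptic]
    [W.IsGloballyMinimal] (K : Type) [Field K] [NumberField K]
    (𝔭 𝔭bar : HeightOneSpectrum (𝓞 K)) (κ : ZpExtension K p) (γ : absoluteGaloisGroup K)
    [Fact (κ.IsTopGenerator γ)] {N : ℕ} [NeZero N] {f : CuspForm (CongruenceSubgroup.Gamma0 N) 2}
    (_ : IsNewformOf W f),
    (N : ℤ) = W.conductorNorm ℤ → 5 ≤ p → W.HasGoodReductionAtPrime p → W.frobeniusTrace p = 0 →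
    Rank1Residual.Surj W p →
    IsImaginaryQuadratic K → ((Ideal.span {(p : ℤ)}).primesOver (𝓞 K)).ncard = 2 →
      ((p : ℕ) : 𝓞 K) ∈ 𝔭.asIdeal →
      (∀ (w : InfinitePlace K) (k : 𝓞 K), k ∈ 𝔭.asIdeal ↔ ‖ι.symm (w.embedding (k : K))‖ < 1) →
      ((p : ℕ) : 𝓞 K) ∈ 𝔭bar.asIdeal → 𝔭bar ≠ 𝔭 →
    (∀ ℓ : ℕ, ℓ.Prime → ℓ ∣ N → ((Ideal.span {(ℓ : ℤ)}).primesOver (𝓞 K)).ncard = 2) →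
    IsCoprime (N : ℤ) (NumberField.discr K) → ¬ p ∣ NumberField.classNumber K →
    (∀ q : ℕ, q.Prime → q ∣ N →
      ∃ v : HeightOneSpectrum (𝓞 ℚ), ((q : ℕ) : 𝓞 ℚ) ∈ v.asIdeal ∧
        ∃ 𝔓 ∈ v.primesAbove, ∃ σ ∈ 𝔓.inertia (absoluteGaloisGroup ℚ),
          ∃ P : W.geomTorsion (p : ℤ), σ • P ≠ P) →
    κ.IsAnticyclotomic →
    ∃ (ΩK : ℂ) (Ωp : (unrIntegers p)ˣ) (L : UnrSeries p),
      ΩK ≠ 0 ∧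
      IsCWBDPLFunction ι 𝔭 κ γ f (NumberField.discr K) ΩK ((Ωp : unrIntegers p) : ℂ_[p]) L ∧
      ∀ (j : ℤ_[p] →+* unrIntegers p),
        (∀ x : ℤ_[p], ((j x : unrIntegers p) : ℂ_[p]) = algebraMap ℚ_[p] ℂ_[p] (x : ℚ_[p])) →
        ∃ k : ℕ,
          Ideal.span {PowerSeries.C ((p : unrIntegers p) ^ k)} *
              (Castella2018.AcSelmer.XAc.charIdeal (W.baseChange K) p κ 𝔭bar ∅ γ).map (PowerSeries.map j) ≤
            Ideal.span {L}

/-- Sanity (PROVED): `C⁺⁺` (this copy) implies the typed printed theorem CHKLL25 Cor. 7.2 — the square-free binder is not used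
(the same one-liner as `AdmdefLine.chkll_of_chkllPlusRat`; it pins that the copy has the line file's binder order). -/
theorem chkll_of_chkllPlusRatE (h : CHKLLPlusRatE) :
    CastellaHsuKunduLeeLiu2025.thm71_cor72_exists_isCWBDPLFunction_charIdeal_map_le_rat := by
  intro p _ ι W _ _ K _ _ 𝔭 𝔭bar κ γ _ N _ f hf hN hp hgood hap hsurj hK hsplit h𝔭 hι h𝔭bar hne
    hHeeg hcop hh _hsq hram hac
  exact h ι W K 𝔭 𝔭bar κ γ hf hN hp hgood hap hsurj hK hsplit h𝔭 hι h𝔭bar hne hHeeg hcop hh hram hac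

/-- `C⁺⁺_NS` — VERBATIM copy of `AdmdefLine.CHKLLPlusRatNS`, the load-bearing research stub of the REGISTERED skeleton
`Lines/admdef.lean` v2 (LEAD bsd-line-sbc-p1 gen 15, sha16 cee32bd27dbcd0ea, commit 451f35fb4a92; `@[conjecture]` there): C⁺⁺ with
the extra binder `¬ Squarefree N` (CHKLL25 (i) NEGATED rather than deleted — the square-free case is the printed theorem). Restated
here (without the attribute) only because a crux workfile cannot import another (`lean check`: `remote:stale:unbuilt:….Lines.admdef`);
the LEAD identifies the two by an `Iff.rfl`-shape `exact`. OPEN (research). [cite: CastellaEtAl2025, Thm. 7.1, Cor. 7.2 (arXiv:2308.10474v2 pp. 29–33)] -/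
def CHKLLPlusRatNSE : Prop :=
  ∀ {p : ℕ} [Fact p.Prime] (ι : PadicAlgCl p ≃+* ℂ) (W : WeierstrassCurve ℚ) [W.IsElliptic]
    [W.IsGloballyMinimal] (K : Type) [Field K] [NumberField K]
    (𝔭 𝔭bar : HeightOneSpectrum (𝓞 K)) (κ : ZpExtension K p) (γ : absoluteGaloisGroup K)
    [Fact (κ.IsTopGenerator γ)] {N : ℕ} [NeZero N] {f : CuspForm (CongruenceSubgroup.Gamma0 N) 2}
    (_ : IsNewformOf W f),
    (N : ℤ) = W.conductorNorm ℤ → 5 ≤ p → W.HasGoodReductionAtPrime p → W.frobeniusTrace p = 0 →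
    Rank1Residual.Surj W p →
    IsImaginaryQuadratic K → ((Ideal.span {(p : ℤ)}).primesOver (𝓞 K)).ncard = 2 →
      ((p : ℕ) : 𝓞 K) ∈ 𝔭.asIdeal →
      (∀ (w : InfinitePlace K) (k : 𝓞 K), k ∈ 𝔭.asIdeal ↔ ‖ι.symm (w.embedding (k : K))‖ < 1) →
      ((p : ℕ) : 𝓞 K) ∈ 𝔭bar.asIdeal → 𝔭bar ≠ 𝔭 →
    (∀ ℓ : ℕ, ℓ.Prime → ℓ ∣ N → ((Ideal.span {(ℓ : ℤ)}).primesOver (𝓞 K)).ncard = 2) →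
    IsCoprime (N : ℤ) (NumberField.discr K) → ¬ p ∣ NumberField.classNumber K →
    -- (i) NEGATED: `N` is NOT square-free (the square-free case is the printed theorem, conjunct 8 of the cite stub)
    ¬ Squarefree N →
    -- (ii): `E[p]` ramified at every prime `q ∣ N`
    (∀ q : ℕ, q.Prime → q ∣ N →
      ∃ v : HeightOneSpectrum (𝓞 ℚ), ((q : ℕ) : 𝓞 ℚ) ∈ v.asIdeal ∧
        ∃ 𝔓 ∈ v.primesAbove, ∃ σ ∈ 𝔓.inertia (absoluteGaloisGroup ℚ),
          ∃ P : W.geomTorsion (p : ℤ), σ • P ≠ P) →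
    κ.IsAnticyclotomic →
    ∃ (ΩK : ℂ) (Ωp : (unrIntegers p)ˣ) (L : UnrSeries p),
      ΩK ≠ 0 ∧
      IsCWBDPLFunction ι 𝔭 κ γ f (NumberField.discr K) ΩK ((Ωp : unrIntegers p) : ℂ_[p]) L ∧
      ∀ (j : ℤ_[p] →+* unrIntegers p),
        (∀ x : ℤ_[p], ((j x : unrIntegers p) : ℂ_[p]) = algebraMap ℚ_[p] ℂ_[p] (x : ℚ_[p])) →
        ∃ k : ℕ,
          Ideal.span {PowerSeries.C ((p : unrIntegers p) ^ k)} *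
              (Castella2018.AcSelmer.XAc.charIdeal (W.baseChange K) p κ 𝔭bar ∅ γ).map (PowerSeries.map j) ≤
            Ideal.span {L}

/-- C⁺⁺ ⟹ C⁺⁺_NS (PROVED: the negated square-free binder is dropped). -/
theorem chkllPlusRatNSE_of_chkllPlusRatE (h : CHKLLPlusRatE) : CHKLLPlusRatNSE := by
  intro p _ ι W _ _ K _ _ 𝔭 𝔭bar κ γ _ N _ f hf hN hp hgood hap hsurj hK hsplit h𝔭 hι h𝔭bar hne hHeeg hcop hh _ hram hac
  exact h ι W K 𝔭 𝔭bar κ γ hf hN hp hgood hap hsurj hK hsplit h𝔭 hι h𝔭bar hne hHeeg hcop hh hram hac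


/-- **THE CERTIFIED CUT (PROVED, plumbing): [E] ∧ [R] ∧ conjunct 3 ∧ conjunct 5 ⟹ C⁺⁺.** From the binders of C⁺⁺: build
`AcSigned.Setting W K p κ 𝔭 𝔭bar` (`a_p = 0` gives `GoodSS`; `5 ≤ p` gives `p ≠ 2`, `3 < p`), get `IsNonsplitIn κ 𝔭` from
`p ∤ h_K` (tree theorem), a local generator `γ𝔭` from that surjectivity, the frame `(Ω_K, Ω_p, L)` and, for `ε = 1`, a class
`z` with `TransferInputs … 1 z L` from conjunct 3; [R] gives the two ranks and the reversed rational Howard inequality; conjunct 5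
turns the ranks into `Sel^{1, rel at 𝔭bar} ≤ Sel_1`; [E] then yields `∃ k′, (p^{k′}) Ch_Λ(X_ac) R₀⟦T⟧ ⊆ (L)` along `j`. -/
theorem chkllPlusRatE_of_transfer
    (h3 : ∀ (N : ℕ) [NeZero N] (W : WeierstrassCurve ℚ) [W.IsGloballyMinimal] (K : Type) [Field K] [NumberField K]
      (p : ℕ) [Fact p.Prime] (κ : ZpExtension K p) (𝔭 𝔭' : HeightOneSpectrum (𝓞 K)),
      castellaWan2024_proofThm68_transferInputs N W K p κ 𝔭 𝔭')
    (h5 : ∀ (N : ℕ) [NeZero N] (W : WeierstrassCurve ℚ) [W.IsGloballyMinimal] (K : Type) [Field K] [NumberField K]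
      (p : ℕ) [Fact p.Prime] (κ : ZpExtension K p) (𝔭 𝔭' : HeightOneSpectrum (𝓞 K)),
      castellaWan2024_proofThm68_selmerRel_le_selmerSgn N W K p κ 𝔭 𝔭')
    (hR : ∀ (N : ℕ) [NeZero N] (W : WeierstrassCurve ℚ) [W.IsGloballyMinimal] (K : Type) [Field K] [NumberField K]
      (p : ℕ) [Fact p.Prime] (κ : ZpExtension K p) (𝔭 𝔭' : HeightOneSpectrum (𝓞 K)),
      HPMCPlusRigidityRat N W K p κ 𝔭 𝔭')
    (hE : EisensteinTransferSS) : CHKLLPlusRatE := by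
  intro p _ ι W _ _ K _ _ 𝔭 𝔭bar κ γ hγF N _ f hf hN hp hgood hap hsurj hK hsplit h𝔭 hι h𝔭bar hne
    hHeeg hcop hh hram hac
  have hp2 : p ≠ 2 := by omega
  have h3p : 3 < p := by omega
  have hS : Setting W K p κ 𝔭 𝔭bar :=
    { isElliptic := ‹_›
      p_ne_two := hp2
      goodSS := ⟨hgood, by rw [hap]; exact dvd_zero _⟩
      frobeniusTrace_eq_zero := hap
      isImaginaryQuadratic := hK
      mem := h𝔭
      mem' := h𝔭bar
      ne := hne
      anticyclotomic := hac
      not_dvd_classNumber := hh }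
  have hN' : (W.conductorNorm ℤ : ℕ) = N := by exact_mod_cast hN.symm
  have hns : IsNonsplitIn κ 𝔭 :=
    Summit.BirchSwinnertonDyer.BirchSwinnertonDyer.Theorems.SignedBaseChangeAcDivAnticyclotomicNonsplit.isNonsplitIn_of_isAnticyclotomic_of_not_dvd_classNumber
      hK hp2 κ hac hh h𝔭
  obtain ⟨γ𝔭, hγ𝔭⟩ := hns (κ γ)
  obtain ⟨ΩK, Ωp, L, hΩ, hBDP, hz⟩ :=
    h3 N W K p κ 𝔭 𝔭bar hS ι hf hN' hHeeg h3p hι γ hγF.out hns γ𝔭 hγ𝔭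
  refine ⟨ΩK, Ωp, L, hΩ, hBDP, fun j hj ↦ ?_⟩
  obtain ⟨z, hT⟩ := hz 1
  obtain ⟨hSr, hXr, hk⟩ :=
    hR N W K p κ 𝔭 𝔭bar hS ι hf hN' hHeeg hp hsurj hcop hram hι γ hγF.out hns γ𝔭 hγ𝔭 ΩK Ωp 1 z L hΩ hBDP hT
  have hRel := h5 N W K p κ 𝔭 𝔭bar hS ι hf hN' hHeeg h3p hι γ hγF.out 1 hSr.2 hXr
  exact hE hT h𝔭bar hSr hXr hRel hk j hj


/-- **THE CERTIFIED CUT, final form (PROVED): conjunct 3 ∧ conjunct 5 ∧ (∀ frame, [R]) ⟹ C⁺⁺** — [E] discharged by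
`eisensteinTransferSS_holds`. The research content of `stub_chkllPlusRat` is exactly [R] `HPMCPlusRigidityRat` (the `±`-HPMC
rigidity in rational form beyond square-free level); the two other inputs are PRINTED Castella–Wan facts taken BY NAME. -/
theorem chkllPlusRatE_of_rigidity
    (h3 : ∀ (N : ℕ) [NeZero N] (W : WeierstrassCurve ℚ) [W.IsGloballyMinimal] (K : Type) [Field K] [NumberField K]
      (p : ℕ) [Fact p.Prime] (κ : ZpExtension K p) (𝔭 𝔭' : HeightOneSpectrum (𝓞 K)),
      castellaWan2024_proofThm68_transferInputs N W K p κ 𝔭 𝔭')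
    (h5 : ∀ (N : ℕ) [NeZero N] (W : WeierstrassCurve ℚ) [W.IsGloballyMinimal] (K : Type) [Field K] [NumberField K]
      (p : ℕ) [Fact p.Prime] (κ : ZpExtension K p) (𝔭 𝔭' : HeightOneSpectrum (𝓞 K)),
      castellaWan2024_proofThm68_selmerRel_le_selmerSgn N W K p κ 𝔭 𝔭')
    (hR : ∀ (N : ℕ) [NeZero N] (W : WeierstrassCurve ℚ) [W.IsGloballyMinimal] (K : Type) [Field K] [NumberField K]
      (p : ℕ) [Fact p.Prime] (κ : ZpExtension K p) (𝔭 𝔭' : HeightOneSpectrum (𝓞 K)),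
      HPMCPlusRigidityRat N W K p κ 𝔭 𝔭') : CHKLLPlusRatE :=
  chkllPlusRatE_of_transfer h3 h5 hR eisensteinTransferSS_holds


/-- **THE CERTIFIED CUT ON THE REGISTERED OBLIGATION (PROVED, rev 4): conjunct 3 ∧ conjunct 5 ∧ (∀ frame, [R_NS]) ⟹ C⁺⁺_NS** —
the composition of `chkllPlusRatE_of_transfer` re-run with the `¬ Squarefree N` binder threaded from C⁺⁺_NS into [R_NS]; [E] is the
theorem `eisensteinTransferSS_holds`. So the research content of the registered stub `stub_chkllPlusRatNS` is, certifiably, the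
`±`-HPMC rigidity in rational form on NON-square-free `N` under CHKLL's remaining hypotheses, in the period-normalised frame. -/
theorem chkllPlusRatNSE_of_rigidityNS
    (h3 : ∀ (N : ℕ) [NeZero N] (W : WeierstrassCurve ℚ) [W.IsGloballyMinimal] (K : Type) [Field K] [NumberField K]
      (p : ℕ) [Fact p.Prime] (κ : ZpExtension K p) (𝔭 𝔭' : HeightOneSpectrum (𝓞 K)),
      castellaWan2024_proofThm68_transferInputs N W K p κ 𝔭 𝔭')
    (h5 : ∀ (N : ℕ) [NeZero N] (W : WeierstrassCurve ℚ) [W.IsGloballyMinimal] (K : Type) [Field K] [NumberField K]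
      (p : ℕ) [Fact p.Prime] (κ : ZpExtension K p) (𝔭 𝔭' : HeightOneSpectrum (𝓞 K)),
      castellaWan2024_proofThm68_selmerRel_le_selmerSgn N W K p κ 𝔭 𝔭')
    (hR : ∀ (N : ℕ) [NeZero N] (W : WeierstrassCurve ℚ) [W.IsGloballyMinimal] (K : Type) [Field K] [NumberField K]
      (p : ℕ) [Fact p.Prime] (κ : ZpExtension K p) (𝔭 𝔭' : HeightOneSpectrum (𝓞 K)),
      HPMCPlusRigidityRatNS N W K p κ 𝔭 𝔭') : CHKLLPlusRatNSE := by
  intro p _ ι W _ _ K _ _ 𝔭 𝔭bar κ γ hγF N _ f hf hN hp hgood hap hsurj hK hsplit h𝔭 hι h𝔭bar hne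
    hHeeg hcop hh hsqf hram hac
  have hp2 : p ≠ 2 := by omega
  have h3p : 3 < p := by omega
  have hS : Setting W K p κ 𝔭 𝔭bar :=
    { isElliptic := ‹_›
      p_ne_two := hp2
      goodSS := ⟨hgood, by rw [hap]; exact dvd_zero _⟩
      frobeniusTrace_eq_zero := hap
      isImaginaryQuadratic := hK
      mem := h𝔭
      mem' := h𝔭bar
      ne := hne
      anticyclotomic := hac
      not_dvd_classNumber := hh }
  have hN' : (W.conductorNorm ℤ : ℕ) = N := by exact_mod_cast hN.symm
  have hns : IsNonsplitIn κ 𝔭 :=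
    Summit.BirchSwinnertonDyer.BirchSwinnertonDyer.Theorems.SignedBaseChangeAcDivAnticyclotomicNonsplit.isNonsplitIn_of_isAnticyclotomic_of_not_dvd_classNumber
      hK hp2 κ hac hh h𝔭
  obtain ⟨γ𝔭, hγ𝔭⟩ := hns (κ γ)
  obtain ⟨ΩK, Ωp, L, hΩ, hBDP, hz⟩ :=
    h3 N W K p κ 𝔭 𝔭bar hS ι hf hN' hHeeg h3p hι γ hγF.out hns γ𝔭 hγ𝔭
  refine ⟨ΩK, Ωp, L, hΩ, hBDP, fun j hj ↦ ?_⟩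
  obtain ⟨z, hT⟩ := hz 1
  obtain ⟨hSr, hXr, hk⟩ :=
    hR N W K p κ 𝔭 𝔭bar hS ι hf hN' hHeeg hp hsurj hcop hsqf hram hι γ hγF.out hns γ𝔭 hγ𝔭 ΩK Ωp 1 z L hΩ hBDP hT
  have hRel := h5 N W K p κ 𝔭 𝔭bar hS ι hf hN' hHeeg h3p hι γ hγF.out 1 hSr.2 hXr
  exact eisensteinTransferSS_holds hT h𝔭bar hSr hXr hRel hk j hj

/-- Sanity (PROVED, trivial): with slack `k = 0` on the hypothesis side the reversed inequality is the plain
`char_t(X_ε) ⊆ ι(char(Sel_ε/Λz))²`; recorded only to pin the orientation of [E] against the Howard theorem's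
`hHoward : ι(char(Sel_ε/Λz))² ≤ char_t(X_ε)`. -/
theorem span_C_pow_zero_mul {p : ℕ} [Fact p.Prime] (I : Ideal (IwasawaAlgebra p)) :
    Ideal.span {PowerSeries.C ((p : ℤ_[p]) ^ 0)} * I = I := by
  rw [pow_zero, map_one, Ideal.span_singleton_one, Ideal.top_mul]

end Summit.BirchSwinnertonDyer.BirchSwinnertonDyer.Cruxes.AnticyclotomicEisensteinDivisibility.AdmdefLine

end
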